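import Summits.Ventures.PercRepro.C026ThreeGadget
import Summits.Ventures.PercRepro.C026HubPair

/-!
# The three-component family (p5, gen 13): non-mark components of at most three vertices

`IsThreeComponentGraph a b c`: every non-mark reaches at most three vertices through edges between
non-marks.  The D-free inequality on the family follows from the gadget theorem and the hub-pair theorem
by splitting off one component at a time (a 3-terminal gluing); marked minors stay in the family; p6's
every-`p` lift gives C-026 at every `p`.
-/

namespace PercRepro

namespace MultiGraph

universe u w

variable {V : Type w}

/-- Non-mark adjacency: an edge joins two non-marks. -/
def NMAdj {E : Type*} (G : MultiGraph V E) (a b c : V) (s t : V) : Prop :=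
  (s ≠ a ∧ s ≠ b ∧ s ≠ c) ∧ (t ≠ a ∧ t ≠ b ∧ t ≠ c) ∧ ∃ e, G.Joins e s t

/-- Non-mark reachability: a path of edges between non-marks. -/
def NMReach {E : Type*} (G : MultiGraph V E) (a b c : V) : V → V → Prop :=
  Relation.ReflTransGen (G.NMAdj a b c)

/-- **The three-component family**: every non-mark reaches at most three vertices through non-marks. -/
def IsThreeComponentGraph {E : Type*} (G : MultiGraph V E) (a b c : V) : Prop :=
  ∀ v, v ≠ a → v ≠ b → v ≠ c → ∃ y z, ∀ w, G.NMReach a b c v w → w = v ∨ w = y ∨ w = z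

section Basic

variable {E : Type*} {G : MultiGraph V E} {a b c : V}

/-- A vertex reached from a non-mark through non-marks is a non-mark. -/
theorem NMReach.nonMark {v w : V} (h : G.NMReach a b c v w) (hv : v ≠ a ∧ v ≠ b ∧ v ≠ c) :
    w ≠ a ∧ w ≠ b ∧ w ≠ c := by
  induction h with
  | refl => exact hv
  | tail _ hst ih => exact hst.2.1

/-- Non-mark reachability is transitive. -/
theorem NMReach.trans' {v w x : V} (h1 : G.NMReach a b c v w) (h2 : G.NMReach a b c w x) :
    G.NMReach a b c v x := Relation.ReflTransGen.trans h1 h2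

/-- A non-mark adjacency is a non-mark reachability. -/
theorem NMReach.single' {v w : V} (h : G.NMAdj a b c v w) : G.NMReach a b c v w :=
  Relation.ReflTransGen.single h

/-- Non-mark adjacency is symmetric. -/
theorem NMAdj.symm' {v w : V} (h : G.NMAdj a b c v w) : G.NMAdj a b c w v := by
  obtain ⟨hv, hw, e, he⟩ := h
  refine ⟨hw, hv, e, ?_⟩
  rcases he with h | h
  · exact Or.inr h
  · exact Or.inl h

/-- Non-mark reachability in a part is non-mark reachability in the graph. -/
theorem NMReach.of_part {side : E → Bool} {s : Bool} {v w : V}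
    (h : (G.part side s).NMReach a b c v w) : G.NMReach a b c v w := by
  induction h with
  | refl => exact Relation.ReflTransGen.refl
  | tail _ hst ih =>
    refine ih.trans' (NMReach.single' ?_)
    obtain ⟨hv, hw, e, he⟩ := hst
    exact ⟨hv, hw, e.1, he⟩

/-- The parts of a gluing of a graph of the family are in the family. -/
theorem IsThreeComponentGraph.part (hG : G.IsThreeComponentGraph a b c) (side : E → Bool) (s : Bool) :
    (G.part side s).IsThreeComponentGraph a b c := by
  intro v hva hvb hvc
  obtain ⟨y, z, hyz⟩ := hG v hva hvb hvc
  exact ⟨y, z, fun w hw => hyz w hw.of_part⟩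

end Basic

/-! ### The split at a component -/

section Split

variable {E : Type*} {G : MultiGraph V E} {a b c x : V}

open Classical in
/-- The side of the split: the edges at a vertex of the non-mark component of `x`. -/
noncomputable def compSide (G : MultiGraph V E) (a b c x : V) (e : E) : Bool :=
  decide (∃ w, G.NMReach a b c x w ∧ G.EdgeAt e w)

/-- Membership in the component side: an edge at a vertex of the component. -/
theorem compSide_eq_true_iff (e : E) :
    G.compSide a b c x e = true ↔ ∃ w, G.NMReach a b c x w ∧ G.EdgeAt e w := by
  classical
  simp [compSide]

variable (hx : x ≠ a ∧ x ≠ b ∧ x ≠ c)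
include hx

open Classical in
/-- An edge at a non-mark `v` is on the side iff `v` is in the component of `x`. -/
theorem compSide_eq_of_edgeAt {v : V} (hv : v ≠ a ∧ v ≠ b ∧ v ≠ c) {e : E} (he : G.EdgeAt e v) :
    G.compSide a b c x e = decide (G.NMReach a b c x v) := by
  classical
  rw [Bool.eq_iff_iff, compSide_eq_true_iff, decide_eq_true_eq]
  constructor
  · rintro ⟨w, hw, hew⟩
    by_cases hwv : w = v
    · subst hwv; exact hw
    · refine hw.trans' (NMReach.single' ⟨hw.nonMark hx, hv, e, joins_of_edgeAt hew he hwv⟩)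
  · intro h
    exact ⟨v, h, he⟩

/-- **The split at a component is a 3-terminal gluing.** -/
theorem isGluing_compSide : G.IsGluing a b c (G.compSide a b c x) := by
  intro v hva hvb hvc e e' he he'
  rw [compSide_eq_of_edgeAt hx ⟨hva, hvb, hvc⟩ he, compSide_eq_of_edgeAt hx ⟨hva, hvb, hvc⟩ he']

/-- The six supported vertices of the component side. -/
def tripleIota (a b c x y z : V) (i : ℕ) : V :=
  if i = 0 then a else if i = 1 then b else if i = 2 then c else if i = 3 then x else if i = 4 then y else z

variable {y z : V} (hbound : ∀ w, G.NMReach a b c x w → w = x ∨ w = y ∨ w = z)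
include hbound

/-- **The component side is supported on `a, b, c, x, y, z`**, every edge at `x`, `y` or `z`. -/
theorem supported_part_compSide :
    (G.part (G.compSide a b c x) true).Supported (tripleIota a b c x y z) 6 ∧
      ∀ e : {e // G.compSide a b c x e = true}, ∃ k, 3 ≤ k ∧ k < 6 ∧
        ((G.part (G.compSide a b c x) true).fst e = tripleIota a b c x y z k ∨
          (G.part (G.compSide a b c x) true).snd e = tripleIota a b c x y z k) := by
  classical
  have hidx : ∀ w, G.NMReach a b c x w → ∃ k, 3 ≤ k ∧ k < 6 ∧ w = tripleIota a b c x y z k := by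
    intro w hw
    rcases hbound w hw with rfl | rfl | rfl
    · exact ⟨3, by norm_num, by norm_num, by simp [tripleIota]⟩
    · exact ⟨4, by norm_num, by norm_num, by simp [tripleIota]⟩
    · exact ⟨5, by norm_num, by norm_num, by simp [tripleIota]⟩
  have hmem : ∀ e : {e // G.compSide a b c x e = true}, ∀ w, G.EdgeAt e.1 w →
      ∃ i < 6, w = tripleIota a b c x y z i := by
    intro e w hw
    by_cases hwm : w = a ∨ w = b ∨ w = c
    · rcases hwm with rfl | rfl | rfl
      · exact ⟨0, by norm_num, rfl⟩
      · exact ⟨1, by norm_num, rfl⟩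
      · exact ⟨2, by norm_num, rfl⟩
    · have hw' : w ≠ a ∧ w ≠ b ∧ w ≠ c :=
        ⟨fun h => hwm (Or.inl h), fun h => hwm (Or.inr (Or.inl h)), fun h => hwm (Or.inr (Or.inr h))⟩
      have hs : G.NMReach a b c x w := by
        have := compSide_eq_of_edgeAt hx hw' hw
        rw [e.2] at this
        exact of_decide_eq_true this.symm
      obtain ⟨k, _, hk, hkw⟩ := hidx w hs
      exact ⟨k, hk, hkw⟩
  refine ⟨fun e => ⟨hmem e _ (Or.inl rfl), hmem e _ (Or.inr rfl)⟩, fun e => ?_⟩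
  obtain ⟨w, hw, hew⟩ := (compSide_eq_true_iff e.1).1 e.2
  obtain ⟨k, hk3, hk, hkw⟩ := hidx w hw
  refine ⟨k, hk3, hk, ?_⟩
  rw [part_fst, part_snd, ← hkw]
  exact hew

end Split

/-- `tripleIota` is injective below `6` when the six vertices are distinct. -/
theorem injBelow_tripleIota {a b c x y z : V} (hab : a ≠ b) (hac : a ≠ c) (hbc : b ≠ c)
    (hx : x ≠ a ∧ x ≠ b ∧ x ≠ c) (hy : y ≠ a ∧ y ≠ b ∧ y ≠ c) (hz : z ≠ a ∧ z ≠ b ∧ z ≠ c)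
    (hxy : x ≠ y) (hxz : x ≠ z) (hyz : y ≠ z) : InjBelow (tripleIota a b c x y z) 6 := by
  intro i hi j hj h
  interval_cases i <;> interval_cases j <;> simp [tripleIota] at h ⊢ <;>
    first
    | exact absurd h hab | exact absurd h hac | exact absurd h hbc
    | exact absurd h hab.symm | exact absurd h hac.symm | exact absurd h hbc.symm
    | exact absurd h hx.1 | exact absurd h hx.2.1 | exact absurd h hx.2.2
    | exact absurd h hx.1.symm | exact absurd h hx.2.1.symm | exact absurd h hx.2.2.symm
    | exact absurd h hy.1 | exact absurd h hy.2.1 | exact absurd h hy.2.2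
    | exact absurd h hy.1.symm | exact absurd h hy.2.1.symm | exact absurd h hy.2.2.symm
    | exact absurd h hz.1 | exact absurd h hz.2.1 | exact absurd h hz.2.2
    | exact absurd h hz.1.symm | exact absurd h hz.2.1.symm | exact absurd h hz.2.2.symm
    | exact absurd h hxy | exact absurd h hxy.symm
    | exact absurd h hxz | exact absurd h hxz.symm
    | exact absurd h hyz | exact absurd h hyz.symm

/-- A component side bounded by two vertices is a hub-pair graph. -/
theorem isHubPair_part_compSide {E : Type*} {G : MultiGraph V E} {a b c x y : V}
    (hx : x ≠ a ∧ x ≠ b ∧ x ≠ c) (hbound : ∀ w, G.NMReach a b c x w → w = x ∨ w = y) :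
    (G.part (G.compSide a b c x) true).IsHubPairGraph a b c := by
  classical
  intro v hva hvb hvc e e' w w' he he' hwv hw'v hw hw'
  have hv : v ≠ a ∧ v ≠ b ∧ v ≠ c := ⟨hva, hvb, hvc⟩
  -- `v` is in the component of `x`
  have hreach : G.NMReach a b c x v := by
    have hev : G.EdgeAt e.1 v := by
      rcases he with ⟨h, _⟩ | ⟨_, h⟩
      · exact Or.inl h
      · exact Or.inr h
    have := compSide_eq_of_edgeAt hx hv hev
    rw [e.2] at this
    exact of_decide_eq_true this.symm
  have hw1 : G.NMReach a b c x w := hreach.trans' (NMReach.single' ⟨hv, hw, e.1, he⟩)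
  have hw2 : G.NMReach a b c x w' := hreach.trans' (NMReach.single' ⟨hv, hw', e'.1, he'⟩)
  rcases hbound v hreach with rfl | rfl
  · rcases hbound w hw1 with h1 | h1 <;> rcases hbound w' hw2 with h2 | h2
    · exact h1.trans h2.symm
    · exact absurd h1 hwv
    · exact absurd h2 hw'v
    · exact h1.trans h2.symm
  · rcases hbound w hw1 with h1 | h1 <;> rcases hbound w' hw2 with h2 | h2
    · exact h1.trans h2.symm
    · exact absurd h2 hw'v
    · exact absurd h1 hwv
    · exact h1.trans h2.symm

/-- From a three-vertex bound that is not three distinct non-marks, a two-vertex bound. -/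
theorem two_bound_of_not_three {E : Type*} {G : MultiGraph V E} {a b c x y z : V}
    (hx : x ≠ a ∧ x ≠ b ∧ x ≠ c) (hbound : ∀ w, G.NMReach a b c x w → w = x ∨ w = y ∨ w = z)
    (hnot : ¬ ((y ≠ a ∧ y ≠ b ∧ y ≠ c) ∧ (z ≠ a ∧ z ≠ b ∧ z ≠ c) ∧ x ≠ y ∧ x ≠ z ∧ y ≠ z)) :
    ∃ y', ∀ w, G.NMReach a b c x w → w = x ∨ w = y' := by
  by_cases hy : y ≠ a ∧ y ≠ b ∧ y ≠ c
  · by_cases hz : z ≠ a ∧ z ≠ b ∧ z ≠ c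
    · by_cases hxy : x = y
      · subst hxy
        exact ⟨z, fun w hw => by rcases hbound w hw with h | h | h <;> simp [h]⟩
      · by_cases hxz : x = z
        · subst hxz
          exact ⟨y, fun w hw => by rcases hbound w hw with h | h | h <;> simp [h]⟩
        · by_cases hyz : y = z
          · subst hyz
            exact ⟨y, fun w hw => by rcases hbound w hw with h | h | h <;> simp [h]⟩
          · exact absurd ⟨hy, hz, hxy, hxz, hyz⟩ hnot
    · -- `z` is a mark: no reached vertex equals it
      refine ⟨y, fun w hw => ?_⟩
      rcases hbound w hw with h | h | h
      · exact Or.inl h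
      · exact Or.inr h
      · exact absurd (h ▸ hw.nonMark hx) hz
  · refine ⟨z, fun w hw => ?_⟩
    rcases hbound w hw with h | h | h
    · exact Or.inl h
    · exact absurd (h ▸ hw.nonMark hx) hy
    · exact Or.inr h

/-! ### The induction -/

/-- **The D-free inequality on the three-component family** (three distinct marks), by strong induction
on the number of edges, from the gadget theorem `hgad` (supported on six vertices, every edge at a
non-mark, injective vertices) and the hub-pair theorem. -/
theorem dFreeIneq_of_threeComponents_card (a b c : V) (hab : a ≠ b) (hac : a ≠ c) (hbc : b ≠ c)
    (hgad : ∀ {W : Type w} {E : Type u} [Fintype E] [DecidableEq E] (G : MultiGraph W E) (ι : ℕ → W),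
      G.Supported ι 6 → InjBelow ι 6 →
      (∀ e, ∃ k, 3 ≤ k ∧ k < 6 ∧ (G.fst e = ι k ∨ G.snd e = ι k)) → G.DFreeIneq (ι 0) (ι 1) (ι 2)) :
    ∀ m : ℕ, ∀ {E : Type u} [Fintype E] [DecidableEq E] (G : MultiGraph V E),
      Fintype.card E = m → G.IsThreeComponentGraph a b c → G.DFreeIneq a b c := by
  intro m
  induction m using Nat.strong_induction_on with
  | _ m ih =>
  intro E _ _ G hm hG
  classical
  by_cases hex : ∃ x, (x ≠ a ∧ x ≠ b ∧ x ≠ c) ∧ ∃ e, G.EdgeAt e x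
  · obtain ⟨x, hx, e₀, he₀⟩ := hex
    obtain ⟨y, z, hbound⟩ := hG x hx.1 hx.2.1 hx.2.2
    have hg := isGluing_compSide (G := G) (a := a) (b := b) (c := c) hx
    have hside : ¬ G.compSide a b c x e₀ = false := by
      intro h
      have := (compSide_eq_true_iff (G := G) (a := a) (b := b) (c := c) (x := x) e₀).2
        ⟨x, Relation.ReflTransGen.refl, he₀⟩
      rw [this] at h
      exact absurd h (by decide)
    have hcard : Fintype.card {e // G.compSide a b c x e = false} < m := by
      rw [← hm]
      exact Fintype.card_subtype_lt hside
    have h₀ := ih _ hcard (G.part (G.compSide a b c x) false) rfl (hG.part _ _)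
    have h₁ : (G.part (G.compSide a b c x) true).DFreeIneq a b c := by
      by_cases h3 : (y ≠ a ∧ y ≠ b ∧ y ≠ c) ∧ (z ≠ a ∧ z ≠ b ∧ z ≠ c) ∧ x ≠ y ∧ x ≠ z ∧ y ≠ z
      · obtain ⟨hy, hz, hxy, hxz, hyz⟩ := h3
        obtain ⟨hsup, hnm⟩ := supported_part_compSide hx hbound
        have := hgad (G.part (G.compSide a b c x) true) (tripleIota a b c x y z) hsup
          (injBelow_tripleIota hab hac hbc hx hy hz hxy hxz hyz) hnm
        simpa [tripleIota] using this
      · obtain ⟨y', hb2⟩ := two_bound_of_not_three hx hbound h3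
        exact dFreeIneq_of_hubPair _ (isHubPair_part_compSide hx hb2) hab hac hbc
    exact dFreeIneq_of_gluing G a b c hab hac hbc _ hg h₁ h₀
  · -- no edge at a non-mark: supported on the marks
    have hsup : G.Supported (pairIota a b c a a) 3 := by
      intro e
      have hmark : ∀ w, G.EdgeAt e w → ∃ i < 3, w = pairIota a b c a a i := by
        intro w hw
        by_cases hwm : w = a ∨ w = b ∨ w = c
        · rcases hwm with rfl | rfl | rfl
          · exact ⟨0, by norm_num, rfl⟩
          · exact ⟨1, by norm_num, rfl⟩
          · exact ⟨2, by norm_num, rfl⟩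
        · exfalso
          exact hex ⟨w, ⟨fun h => hwm (Or.inl h), fun h => hwm (Or.inr (Or.inl h)),
            fun h => hwm (Or.inr (Or.inr h))⟩, e, hw⟩
      exact ⟨hmark _ (Or.inl rfl), hmark _ (Or.inr rfl)⟩
    have hinj : InjBelow (pairIota a b c a a) 3 := by
      intro i hi j hj h
      interval_cases i <;> interval_cases j <;> simp [pairIota] at h ⊢ <;>
        first
        | exact absurd h hab | exact absurd h hac | exact absurd h hbc
        | exact absurd h hab.symm | exact absurd h hac.symm | exact absurd h hbc.symm
    exact dFreeIneq_of_supported3 hsup hinj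

/-! ### Minors -/

/-- An open path inside a non-mark class is a non-mark path. -/
theorem nmReach_of_conn_class {E : Type*} {G : MultiGraph V E} {a b c : V} (v : Config E) {s t : V}
    (h : G.Conn v s t) (hcls : G.sureClass v s ≠ G.sureClass v a ∧ G.sureClass v s ≠ G.sureClass v b ∧
      G.sureClass v s ≠ G.sureClass v c) : G.NMReach a b c s t := by
  induction h with
  | refl => exact Relation.ReflTransGen.refl
  | @tail p q hsp hpq ih =>
    refine ih.trans' (NMReach.single' ?_)
    have hp : G.sureClass v p = G.sureClass v s := ((G.sureClass_eq_iff v s p).2 hsp).symm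
    have hq : G.sureClass v q = G.sureClass v s := by
      rw [← hp]; exact ((G.sureClass_eq_iff v p q).2 (Conn.of_openAdj hpq)).symm
    have hpm := nonMark_of_sureClass_ne G v hcls.1 hcls.2.1 hcls.2.2 hp
    have hqm := nonMark_of_sureClass_ne G v hcls.1 hcls.2.1 hcls.2.2 hq
    obtain ⟨e, _, he⟩ := hpq
    exact ⟨hpm, hqm, e, he⟩

/-- **Marked minors of three-component graphs are three-component graphs.** -/
theorem IsThreeComponentGraph.minor {E : Type*} {G : MultiGraph V E} {a b c : V}
    (hG : G.IsThreeComponentGraph a b c) (u v : Config E) :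
    (G.minor u v).IsThreeComponentGraph (G.sureClass v a) (G.sureClass v b) (G.sureClass v c) := by
  intro z' hza hzb hzc
  obtain ⟨t, rfl⟩ := Quotient.exists_rep z'
  have htm := nonMark_of_sureClass_ne G v hza hzb hzc (rfl : G.sureClass v t = G.sureClass v t)
  obtain ⟨y, z, hbound⟩ := hG t htm.1 htm.2.1 htm.2.2
  refine ⟨G.sureClass v y, G.sureClass v z, ?_⟩
  -- every class reached in the minor is the class of a vertex reached in `G`
  have key : ∀ w', (G.minor u v).NMReach (G.sureClass v a) (G.sureClass v b) (G.sureClass v c)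
      (G.sureClass v t) w' → ∃ w, G.NMReach a b c t w ∧ G.sureClass v w = w' := by
    intro w' hw'
    induction hw' with
    | refl => exact ⟨t, Relation.ReflTransGen.refl, rfl⟩
    | @tail p' q' _ hpq ih =>
      obtain ⟨w₁, hw₁, hw₁'⟩ := ih
      obtain ⟨hp', hq', f, hf⟩ := hpq
      -- lift the edge of the minor
      have lift : ∃ z₁ z₂, G.sureClass v z₁ = p' ∧ G.sureClass v z₂ = q' ∧ G.Joins f.1 z₁ z₂ := by
        rcases hf with ⟨h1, h2⟩ | ⟨h1, h2⟩
        · exact ⟨G.fst f.1, G.snd f.1, h1, h2, Or.inl ⟨rfl, rfl⟩⟩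
        · exact ⟨G.snd f.1, G.fst f.1, h2, h1, Or.inr ⟨rfl, rfl⟩⟩
      obtain ⟨z₁, z₂, hz₁, hz₂, hj⟩ := lift
      have hz₁m := nonMark_of_sureClass_ne G v hp'.1 hp'.2.1 hp'.2.2 hz₁
      have hz₂m := nonMark_of_sureClass_ne G v hq'.1 hq'.2.1 hq'.2.2 hz₂
      -- from `w₁` to `z₁` inside the class `p'`
      have hconn : G.Conn v w₁ z₁ := (G.sureClass_eq_iff v w₁ z₁).1 (hw₁'.trans hz₁.symm)
      have hcls : G.sureClass v w₁ ≠ G.sureClass v a ∧ G.sureClass v w₁ ≠ G.sureClass v b ∧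
          G.sureClass v w₁ ≠ G.sureClass v c := by
        rw [hw₁']; exact hp'
      have h1 : G.NMReach a b c w₁ z₁ := nmReach_of_conn_class v hconn hcls
      exact ⟨z₂, (hw₁.trans' h1).trans' (NMReach.single' ⟨hz₁m, hz₂m, f.1, hj⟩), hz₂⟩
  intro w' hw'
  obtain ⟨w, hw, rfl⟩ := key w' hw'
  rcases hbound w hw with rfl | rfl | rfl
  · exact Or.inl rfl
  · exact Or.inr (Or.inl rfl)
  · exact Or.inr (Or.inr rfl)

/-- **C-026 on every three-component multigraph at every `p`**, from the gadget theorem. -/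
theorem c026_threeComponents_of_gadget {E : Type u} [Fintype E] [DecidableEq E] (G : MultiGraph V E)
    {a b c : V} (hG : G.IsThreeComponentGraph a b c)
    (hgad : ∀ {W : Type w} {E : Type u} [Fintype E] [DecidableEq E] (G : MultiGraph W E) (ι : ℕ → W),
      G.Supported ι 6 → InjBelow ι 6 →
      (∀ e, ∃ k, 3 ≤ k ∧ k < 6 ∧ (G.fst e = ι k ∨ G.snd e = ι k)) → G.DFreeIneq (ι 0) (ι 1) (ι 2))
    (p : E → ℝ) (hp : IsProb p) :
    (G.law3 p a b c 0 + G.law3 p a b c 1) * (G.law3 p a b c 1 + G.law3 p a b c 4) ≤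
      G.law3 p a b c 1 + G.law3 p a b c 2 + G.law3 p a b c 3 := by
  classical
  refine c026_of_dFree_minors G a b c (fun u v _ => ?_) p hp
  by_cases h : G.sureClass v a = G.sureClass v b ∨ G.sureClass v a = G.sureClass v c ∨
      G.sureClass v b = G.sureClass v c
  · exact dFreeIneq_of_marks_eq _ h
  · exact dFreeIneq_of_threeComponents_card _ _ _ (fun h1 => h (Or.inl h1))
      (fun h2 => h (Or.inr (Or.inl h2))) (fun h3 => h (Or.inr (Or.inr h3))) hgad _ (G.minor u v) rfl
      (hG.minor u v)


/-- **C-026 at every `p` on every three-component multigraph**: for every finite marked multigraph in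
which every non-mark reaches at most three vertices through non-marks, every `p ∈ [0,1]^E` and the marks
`a, b, c`, `(x + y₁)(y₁ + z) ≤ y₁ + y₂ + y₃`, i.e. `P(a~b)·P(c ≁ {a,b}) ≤ P(one pair)`. -/
theorem c026_threeComponents {E : Type u} [Fintype E] [DecidableEq E] (G : MultiGraph V E)
    {a b c : V} (hG : G.IsThreeComponentGraph a b c) (p : E → ℝ) (hp : IsProb p) :
    (G.law3 p a b c 0 + G.law3 p a b c 1) * (G.law3 p a b c 1 + G.law3 p a b c 4) ≤
      G.law3 p a b c 1 + G.law3 p a b c 2 + G.law3 p a b c 3 :=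
  c026_threeComponents_of_gadget G hG
    (fun _ _ hsup hinj hnm => dFreeIneq_of_supported6 hinj hnm hsup Plane6.table) p hp

end MultiGraph

end PercRepro
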